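import Literature.NumberTheory.LFunctions.VinogradovKorobovZeroDetector
import HarnessLib

/-!
# Ford's kernel `w = g ⋆ g` is continuously differentiable (the regularity input of Ford 2002, Lemma 4.5)

Topic `Literature/NumberTheory/LFunctions`. Part of the decomposition of the explicit
Vinogradov–Korobov zero-free region of Mossinghoff–Trudgian–Yang (architecture in
`VinogradovKorobov.lean`). The in-tree assembly of MTY Lemma 4.7
(`zero_inequality_mossinghoff_trudgian_yang_of_ford`, `VinogradovKorobovZeroDetector.lean`) takes as
hypothesis `hker : ∀ θ ∈ (0, π/2), FordKernelFacts θ`, whose field `contDiff` asks that Ford's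
kernel `w = g ⋆ g` (the smoothing function of Ford's Lemma 4.5 / MTY Lemma 4.2 must have a
continuous derivative) be `C¹`. This file PROVES it (`contDiff_fordKernelW`) for the kernel DEFINED
in Lean, from the tree's explicit form of `w` on `[0, 2θ cot θ]` (`fordKernelW_eq_explicit`), its
evenness (`fordKernelW_neg`) and its vanishing off `[−2θ cot θ, 2θ cot θ]` (`fordKernelW_eq_zero`):
the explicit derivative vanishes at `u = 0` and at `u = 2θ cot θ` (and `w(2θ cot θ) = 0`), so the
one-sided derivatives glue (`HasDerivWithinAt.union`) and the resulting derivative is continuous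
(`Continuous.if_le`); `contDiff_one_iff_deriv` concludes.

No named fact is introduced; the only definitions are the explicit derivative and its extension.

## References

* K. Ford, *Zero-free regions for the Riemann zeta function*, Number Theory for the Millennium II
  (2002), 25–56 = arXiv:1910.08205, Lemma 4.5 ("`f` … has continuous derivative") and §6.
  (`Ford2002Millennium`)
-/

noncomputable section

open Real Set Filter
open scoped Topology

namespace Literature.NumberTheory.LFunctions

namespace FordKernelC1

/-- The derivative of the explicit form of `w` on `[0, 2θ cot θ]`:
`c⁴ E'(u) = −½ cos(u tan θ) − (θ cot θ − cos²θ − u/2) tan θ sin(u tan θ)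
+ (cos θ (2cos²θ + 1)/(2 sin θ)) tan θ cos(u tan θ) − cos²θ`. [folklore] -/
def explicitDeriv (θ u : ℝ) : ℝ :=
  (-(1 / 2) * Real.cos (u * Real.tan θ)
    - (θ * Real.cot θ - Real.cos θ ^ 2 - u / 2) * Real.tan θ * Real.sin (u * Real.tan θ)
    + Real.cos θ * (2 * Real.cos θ ^ 2 + 1) / (2 * Real.sin θ) * Real.tan θ * Real.cos (u * Real.tan θ)
    - Real.cos θ ^ 2) / Real.cos θ ^ 4

/-- `E' = explicitDeriv` is the derivative of `fordKernelWExplicit θ`. [folklore] -/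
theorem hasDerivAt_explicit (θ u : ℝ) :
    HasDerivAt (fordKernelWExplicit θ) (explicitDeriv θ u) u := by
  have hk : HasDerivAt (fun u : ℝ ↦ u * Real.tan θ) (1 * Real.tan θ) u := (hasDerivAt_id u).mul_const _
  have hcos : HasDerivAt (fun u : ℝ ↦ Real.cos (u * Real.tan θ))
      (-Real.sin (u * Real.tan θ) * (1 * Real.tan θ)) u := hk.cos
  have hsin : HasDerivAt (fun u : ℝ ↦ Real.sin (u * Real.tan θ))
      (Real.cos (u * Real.tan θ) * (1 * Real.tan θ)) u := hk.sin
  have hA : HasDerivAt (fun u : ℝ ↦ θ * Real.cot θ - Real.cos θ ^ 2 - u / 2) (0 - 1 / 2) u := by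
    have := ((hasDerivAt_id u).div_const 2)
    have h2 : HasDerivAt (fun u : ℝ ↦ θ * Real.cot θ - Real.cos θ ^ 2 - u / 2) (-(1 / 2)) u := by
      simpa using this.const_sub (θ * Real.cot θ - Real.cos θ ^ 2)
    exact h2.congr_deriv (by ring)
  have hlin : HasDerivAt (fun u : ℝ ↦ Real.cos θ ^ 2 * (2 * (θ * Real.cot θ) - 2 - u))
      (Real.cos θ ^ 2 * (0 - 1)) u := by
    have := ((hasDerivAt_id u).const_sub (2 * (θ * Real.cot θ) - 2)).const_mul (Real.cos θ ^ 2)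
    exact this.congr_deriv (by simp)
  have h : HasDerivAt (fun u : ℝ ↦
      ((θ * Real.cot θ - Real.cos θ ^ 2 - u / 2) * Real.cos (u * Real.tan θ)
        + Real.cos θ * (2 * Real.cos θ ^ 2 + 1) / (2 * Real.sin θ) * Real.sin (u * Real.tan θ)
        + Real.cos θ ^ 2 * (2 * (θ * Real.cot θ) - 2 - u)) / Real.cos θ ^ 4) _ u :=
    (((hA.fun_mul hcos).fun_add (hsin.const_mul _)).fun_add hlin).div_const _
  show HasDerivAt (fun u : ℝ ↦
      ((θ * Real.cot θ - Real.cos θ ^ 2 - u / 2) * Real.cos (u * Real.tan θ)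
        + Real.cos θ * (2 * Real.cos θ ^ 2 + 1) / (2 * Real.sin θ) * Real.sin (u * Real.tan θ)
        + Real.cos θ ^ 2 * (2 * (θ * Real.cot θ) - 2 - u)) / Real.cos θ ^ 4) _ u
  refine h.congr_deriv ?_
  unfold explicitDeriv
  ring

/-- The explicit derivative is continuous. [folklore] -/
theorem continuous_explicitDeriv (θ : ℝ) : Continuous (explicitDeriv θ) := by
  unfold explicitDeriv; fun_prop

section facts

variable {θ : ℝ} (hθ : 0 < θ) (hθ' : θ < π / 2)
include hθ hθ'

/-- `E'(0) = 0`. [folklore] -/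
theorem explicitDeriv_zero : explicitDeriv θ 0 = 0 := by
  have hs := ford_sin_pos hθ hθ'
  have hc := ford_cos_pos hθ hθ'
  unfold explicitDeriv
  rw [zero_mul, Real.cos_zero, Real.sin_zero, Real.tan_eq_sin_div_cos]
  field_simp
  ring

/-- `E'(2θ cot θ) = 0`. [folklore] -/
theorem explicitDeriv_top : explicitDeriv θ (2 * (θ * Real.cot θ)) = 0 := by
  have hs := ford_sin_pos hθ hθ'
  have hc := ford_cos_pos hθ hθ'
  have hL : 2 * (θ * Real.cot θ) * Real.tan θ = 2 * θ := by
    have := ford_cot_mul_tan hθ hθ'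
    linear_combination 2 * this
  have hsq := Real.sin_sq_add_cos_sq θ
  unfold explicitDeriv
  rw [hL, Real.sin_two_mul, Real.cos_two_mul, Real.tan_eq_sin_div_cos]
  field_simp
  linear_combination (4 * Real.cos θ ^ 2) * hsq

/-- `E(2θ cot θ) = 0` (so `w(2θ cot θ) = 0`). [folklore] -/
theorem explicit_top : fordKernelWExplicit θ (2 * (θ * Real.cot θ)) = 0 := by
  have hs := ford_sin_pos hθ hθ'
  have hc := ford_cos_pos hθ hθ'
  have hL : 2 * (θ * Real.cot θ) * Real.tan θ = 2 * θ := by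
    have := ford_cot_mul_tan hθ hθ'
    linear_combination 2 * this
  unfold fordKernelWExplicit
  rw [hL, Real.sin_two_mul, Real.cos_two_mul]
  field_simp
  ring

/-- `w(2θ cot θ) = 0`. [folklore] -/
theorem fordKernelW_top : fordKernelW θ (2 * (θ * Real.cot θ)) = 0 := by
  have ha := ford_cot_pos hθ hθ'
  rw [fordKernelW_eq_explicit hθ hθ' (by positivity) le_rfl]
  exact explicit_top hθ hθ'

/-! ## The derivative of `w` on all of `ℝ` -/

/-- The derivative of `w` on `[0, ∞)`: `E'` on `[0, 2θ cot θ]`, `0` beyond. [folklore] -/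
def derivPos (θ v : ℝ) : ℝ := if v ≤ 2 * (θ * Real.cot θ) then explicitDeriv θ v else 0

/-- The derivative of `w` on `ℝ` (odd extension of `derivPos`). [folklore] -/
def wDeriv (θ u : ℝ) : ℝ := if u ≤ 0 then -derivPos θ (-u) else derivPos θ u

/-- `derivPos` is continuous (`E'(2θ cot θ) = 0`). [folklore] -/
theorem continuous_derivPos : Continuous (derivPos θ) :=
  Continuous.if_le (continuous_explicitDeriv θ) continuous_const continuous_id continuous_const
    (fun v hv ↦ by rw [hv]; exact explicitDeriv_top hθ hθ')

/-- `wDeriv` is continuous (`E'(0) = 0`). [folklore] -/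
theorem continuous_wDeriv : Continuous (wDeriv θ) := by
  refine Continuous.if_le (((continuous_derivPos hθ hθ').comp continuous_neg).neg)
    (continuous_derivPos hθ hθ') continuous_id continuous_const (fun u hu ↦ ?_)
  have ha := ford_cot_pos hθ hθ'
  simp only [hu, neg_zero, derivPos, if_pos (by positivity : (0:ℝ) ≤ 2 * (θ * Real.cot θ)),
    explicitDeriv_zero hθ hθ']

/-- On `(0, 2θ cot θ)`: `w' = E'`. [folklore] -/
theorem hasDerivAt_of_mem_Ioo {u : ℝ} (hu0 : 0 < u) (huL : u < 2 * (θ * Real.cot θ)) :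
    HasDerivAt (fordKernelW θ) (explicitDeriv θ u) u := by
  refine (hasDerivAt_explicit θ u).congr_of_eventuallyEq ?_
  filter_upwards [Ioo_mem_nhds hu0 huL] with v hv using fordKernelW_eq_explicit hθ hθ' hv.1.le hv.2.le

/-- Beyond `2θ cot θ`: `w' = 0`. [folklore] -/
theorem hasDerivAt_of_top_lt {u : ℝ} (huL : 2 * (θ * Real.cot θ) < u) :
    HasDerivAt (fordKernelW θ) 0 u := by
  have ha := ford_cot_pos hθ hθ'
  refine (hasDerivAt_const u (0 : ℝ)).congr_of_eventuallyEq ?_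
  filter_upwards [Ioi_mem_nhds huL] with v hv
  exact fordKernelW_eq_zero (by rw [abs_of_pos (by linarith [mem_Ioi.1 hv])]; exact hv)

/-- At `u = 2θ cot θ`: `w' = 0` (both one-sided derivatives vanish). [folklore] -/
theorem hasDerivAt_top : HasDerivAt (fordKernelW θ) 0 (2 * (θ * Real.cot θ)) := by
  have ha := ford_cot_pos hθ hθ'
  set L : ℝ := 2 * (θ * Real.cot θ) with hLdef
  have hL0 : 0 < L := by positivity
  -- left
  have hl : HasDerivWithinAt (fordKernelW θ) 0 (Iic L) L := by
    have hE : HasDerivWithinAt (fordKernelWExplicit θ) 0 (Iic L) L := by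
      have := (hasDerivAt_explicit θ L).hasDerivWithinAt (s := Iic L)
      rwa [explicitDeriv_top hθ hθ'] at this
    refine hE.congr_of_eventuallyEq ?_ (fordKernelW_eq_explicit hθ hθ' hL0.le le_rfl)
    filter_upwards [inter_mem_nhdsWithin (Iic L) (Ioi_mem_nhds hL0)] with v hv
    exact fordKernelW_eq_explicit hθ hθ' (le_of_lt hv.2) hv.1
  -- right
  have hr : HasDerivWithinAt (fordKernelW θ) 0 (Ici L) L := by
    refine (hasDerivWithinAt_const L (Ici L) (0 : ℝ)).congr_of_eventuallyEq ?_ (fordKernelW_top hθ hθ')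
    filter_upwards [self_mem_nhdsWithin] with v hv
    rcases eq_or_lt_of_le (mem_Ici.1 hv) with h | h
    · rw [← h]; exact fordKernelW_top hθ hθ'
    · exact fordKernelW_eq_zero (by rw [abs_of_pos (by linarith)]; exact h)
  exact (hl.union hr).hasDerivAt (by rw [Iic_union_Ici]; exact univ_mem)

/-- At `u = 0`: `w' = 0` (evenness; `E'(0) = 0`). [folklore] -/
theorem hasDerivAt_zero : HasDerivAt (fordKernelW θ) 0 0 := by
  have ha := ford_cot_pos hθ hθ'
  set L : ℝ := 2 * (θ * Real.cot θ) with hLdef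
  have hL0 : 0 < L := by positivity
  -- right
  have hr : HasDerivWithinAt (fordKernelW θ) 0 (Ici 0) 0 := by
    have hE : HasDerivWithinAt (fordKernelWExplicit θ) 0 (Ici 0) 0 := by
      have := (hasDerivAt_explicit θ 0).hasDerivWithinAt (s := Ici 0)
      rwa [explicitDeriv_zero hθ hθ'] at this
    refine hE.congr_of_eventuallyEq ?_ (fordKernelW_eq_explicit hθ hθ' le_rfl hL0.le)
    filter_upwards [inter_mem_nhdsWithin (Ici 0) (Iio_mem_nhds hL0)] with v hv
    exact fordKernelW_eq_explicit hθ hθ' hv.1 (le_of_lt hv.2)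
  -- left: `w(v) = E(-v)` for `-L ≤ v ≤ 0`
  have hl : HasDerivWithinAt (fordKernelW θ) 0 (Iic 0) 0 := by
    have hE : HasDerivAt (fordKernelWExplicit θ ∘ Neg.neg) 0 0 := by
      have h := (hasDerivAt_explicit θ (-0)).comp (0 : ℝ) (hasDerivAt_neg (0 : ℝ))
      refine h.congr_deriv ?_
      rw [neg_zero, explicitDeriv_zero hθ hθ']; ring
    refine (hE.hasDerivWithinAt (s := Iic 0)).congr_of_eventuallyEq ?_ ?_
    · filter_upwards [inter_mem_nhdsWithin (Iic 0) (Ioi_mem_nhds (by linarith : -L < 0))] with v hv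
      rw [Function.comp_apply, ← fordKernelW_neg v]
      exact fordKernelW_eq_explicit hθ hθ' (by linarith [mem_Iic.1 hv.1]) (by linarith [mem_Ioi.1 hv.2])
    · rw [Function.comp_apply, neg_zero]
      exact fordKernelW_eq_explicit hθ hθ' le_rfl hL0.le
  exact (hl.union hr).hasDerivAt (by rw [Iic_union_Ici]; exact univ_mem)

/-- For `u > 0`: `w'(u) = wDeriv θ u`. [folklore] -/
theorem hasDerivAt_of_pos {u : ℝ} (hu : 0 < u) : HasDerivAt (fordKernelW θ) (wDeriv θ u) u := by
  have hw : wDeriv θ u = derivPos θ u := by simp [wDeriv, not_le.2 hu]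
  rw [hw]
  rcases lt_trichotomy u (2 * (θ * Real.cot θ)) with h | h | h
  · rw [derivPos, if_pos h.le]; exact hasDerivAt_of_mem_Ioo hθ hθ' hu h
  · rw [derivPos, if_pos h.le, h, explicitDeriv_top hθ hθ']; exact hasDerivAt_top hθ hθ'
  · rw [derivPos, if_neg (not_le.2 h)]; exact hasDerivAt_of_top_lt hθ hθ' h

/-- **`w' = wDeriv θ` everywhere.** [folklore] -/
theorem hasDerivAt_fordKernelW (u : ℝ) : HasDerivAt (fordKernelW θ) (wDeriv θ u) u := by
  rcases lt_trichotomy u 0 with h | rfl | h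
  · -- reflect the positive case
    have hp := hasDerivAt_of_pos hθ hθ' (neg_pos.2 h)
    have hcomp := hp.comp u (hasDerivAt_neg u)
    have hfun : (fordKernelW θ ∘ Neg.neg) = fordKernelW θ := funext fun x ↦ fordKernelW_neg x
    rw [hfun] at hcomp
    refine hcomp.congr_deriv ?_
    have h1 : wDeriv θ u = -derivPos θ (-u) := by simp [wDeriv, h.le]
    have h2 : wDeriv θ (-u) = derivPos θ (-u) := by simp [wDeriv, not_le.2 (neg_pos.2 h)]
    rw [h1, h2]; ring
  · have hw : wDeriv θ 0 = 0 := by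
      have ha := ford_cot_pos hθ hθ'
      simp [wDeriv, derivPos, explicitDeriv_zero hθ hθ']
    rw [hw]; exact hasDerivAt_zero hθ hθ'
  · exact hasDerivAt_of_pos hθ hθ' h

/-- **Ford's kernel `w = g ⋆ g` is `C¹`** — the `contDiff` field of `FordKernelFacts θ` (the
regularity of the smoothing function `f(u) = λe^{λu}w(λu)` required by Ford's Lemma 4.5).
[cite: Ford2002Millennium, Lemma 4.5] -/
theorem contDiff_fordKernelW : ContDiff ℝ 1 (fordKernelW θ) := by
  have hd : ∀ u, HasDerivAt (fordKernelW θ) (wDeriv θ u) u := hasDerivAt_fordKernelW hθ hθ'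
  have hderiv : deriv (fordKernelW θ) = wDeriv θ := funext fun u ↦ (hd u).deriv
  refine contDiff_one_iff_deriv.2 ⟨fun u ↦ (hd u).differentiableAt, ?_⟩
  rw [hderiv]
  exact continuous_wDeriv hθ hθ'

end facts

end FordKernelC1

end Literature.NumberTheory.LFunctions
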